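import Mathlib
import HarnessLib.Audit
import Summits.PneNP.PneNP.Theorems.PstarNorUnitEQ1Three

/-!
# The single-(EQ)-chord corner with ONE forest witness (union port of `PstarNorUnitEQ1Three.eq1_three`; ROUND-24, memo §14.21–§14.24)

FRONTIER range-avoidance ladder, rung F-N3, ROUND 24 (cell `pnp-ideate`, planner memo `r24/CORE-BOUND-NOTES.md` §9 / §14.21 (Case B of the union lemma, single-chord world);
restricted-model proof complexity — nothing here bears on `P` versus `NP`).

`PstarNorUnitEQ1Three.eq1_three` (N = {e₀}, all private reads on the line of `m`, `Q_{D e₀} = q_m + κ` ⟹ `#J₀ = 3`) assumes minimality (M0) in EVERY output but USES it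
only at the chord `e₀` and at ONE (arbitrary) path edge `j ∈ D e₀`.  `eq1_one_witness` is the same theorem and the same proof with exactly those two witnesses as
hypotheses — the form the union cover supplies (a chord-minimal system and one forest output released in it).  Everything else is verbatim.
-/

set_option linter.dupNamespace false -- `Summit.PneNP.PneNP.…`: summit = sub-problem name (D-0017 single-conjunct layout)

open Finset Module Literature.Computability.Complexity
open Summit.PneNP.PneNP.Theorems.PstarFibrePolys (bit)
open Summit.PneNP.PneNP.Theorems.PstarTyped (Typed)
open Summit.PneNP.PneNP.Theorems.PstarSALevel (varSet bdry BoundaryExpanding SimpleOverlap)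
open Summit.PneNP.PneNP.Theorems.PstarCoreBound (XorClosed)
open Summit.PneNP.PneNP.Theorems.PstarGapLinearised (andPair)
open Summit.PneNP.PneNP.Theorems.PstarCubeIdeals (IsAffineFn)
open Summit.PneNP.PneNP.Theorems.PstarQuadRank (rad)
open Summit.PneNP.PneNP.Theorems.PstarForcing (polar_unique forcing_cases)
open Summit.PneNP.PneNP.Theorems.PstarProductRank (qform polar)
open Summit.PneNP.PneNP.Theorems.PstarPathRank (AndAdj polar_basis)
open Summit.PneNP.PneNP.Theorems.PstarChordSystem (ChordSystem)
open Summit.PneNP.PneNP.Theorems.PstarChordSystemMap (mapSys toX partner mapSys_u mapSys_t mapSys_val toX_snd U1_package)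
open Summit.PneNP.PneNP.Theorems.PstarChordBridgeTools (xpdeg privs vars_mem_privs)
open Summit.PneNP.PneNP.Theorems.PstarChordBridge (BridgeData sys Solution Lift sys_ρ_of_not_mem infeasible_of_not_solution
  chordMinimal_of_solution_erase)
open Summit.PneNP.PneNP.Theorems.PstarReadSumset (V2)
open Summit.PneNP.PneNP.Theorems.PstarChordBridgeFundamental (two_le_card_of_even)
open Summit.PneNP.PneNP.Theorems.PstarChordBridgeForcing (gam sys_u_eq qform_add' rank_four_of_wf const_of_unread)
open Summit.PneNP.PneNP.Theorems.PstarChordBridgeCotree (Peelable)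
open Summit.PneNP.PneNP.Theorems.PstarChordBridgeBasis (qDir polarDir q_dir)
open Summit.PneNP.PneNP.Theorems.PstarChordBridgeForest (forest_minimality defect_eq_one)
open Summit.PneNP.PneNP.Theorems.PstarNorUnitEQ1Tools (toX_fst q_par polarDir_single_pair nor_unit_of_dir_const)
open Summit.PneNP.PneNP.Theorems.PstarChordBridgeCorner (andAdj_iff_mem qDir_add)
open Summit.PneNP.PneNP.Theorems.PstarNorUnitRegime (J₀_eq_of_single regime_partition)
open Summit.PneNP.PneNP.Theorems.PstarNorUnitExcCore (exc_unit_core)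
open Summit.PneNP.PneNP.Theorems.PstarChordBridgeKill (killable_pair)

namespace Summit.PneNP.PneNP.Theorems.PstarUnionEQ1Witness

variable {n m : ℕ}

/-- **The single-(EQ)-chord corner is a triangle — one-witness form.**  Hypotheses of `PstarNorUnitEQ1Three.eq1_three` with (M0) replaced by: a solution of
`(J₀ − e₀) ∧ Γ₁ ∧ Γ₂` and, for ONE path edge `j ∈ D e₀`, a solution of `(J₀ − j) ∧ Γ₁ ∧ Γ₂`. -/
theorem eq1_one_witness (I : LocalMap 4 n m) (hI : I.IsPure xorAndPred) (hT : Typed I) (hS : SimpleOverlap I) {r : ℕ}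
    (hB : BoundaryExpanding r I) {B : BridgeData n m} (hW : B.WF I) (hr : (B.J₀ ∪ B.G₁ ∪ B.G₂).card ≤ r)
    (hX : XorClosed I B.J₀) (hP : Peelable I (B.J₀ \ B.N)) (hG₁ : Disjoint B.G₁ B.J₀) (hG₂ : Disjoint B.G₂ B.J₀) (hL : Lift I B)
    (hun : ∀ v ∈ privs I B.N, (∀ g ∈ B.G₁, I.vars g 2 ≠ v ∧ I.vars g 3 ≠ v) ∧ ∀ g ∈ B.G₂, I.vars g 2 ≠ v ∧ I.vars g 3 ≠ v)
    (hT3 : ¬ ∃ z, Solution I B B.J₀ z)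
    {mv : V2} (hmv : mv ≠ 0)
    (hreads : ∀ e ∈ B.N, ((sys I B).ρ e 0 = 0 ∨ (sys I B).ρ e 0 = mv) ∧ ((sys I B).ρ' e 0 = 0 ∨ (sys I B).ρ' e 0 = mv))
    {e₀ : Fin m} (hN : B.N = {e₀}) {κ : ZMod 2}
    (hEQ : ∀ x, qform (B.D e₀) (fun j => I.vars j 2) (fun j => I.vars j 3) x = qDir I B mv x + κ)
    (hmin0 : ∃ z, Solution I B (B.J₀.erase e₀) z) {j : Fin m} (hj : j ∈ B.D e₀) {z : Fin n → Bool} (hz : Solution I B (B.J₀.erase j) z) :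
    B.J₀.card = 3 := by
  classical
  -- `𝔽₂` bookkeeping
  have z01 : ∀ a : ZMod 2, a = 0 ∨ a = 1 := by decide
  have zaa : ∀ a : ZMod 2, a + a = 0 := by decide
  have he₀ : e₀ ∈ B.N := by rw [hN]; exact mem_singleton_self _
  have heD : e₀ ∉ B.D e₀ := fun h => (mem_sdiff.1 (hW.hD e₀ he₀ h)).2 he₀
  have hJr : B.J₀.card ≤ r := (card_le_card (subset_union_left.trans subset_union_left)).trans hr
  have heG : e₀ ∉ B.G₁ ∪ B.G₂ := fun h => by
    rcases mem_union.1 h with h | h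
    · exact Finset.disjoint_left.1 hG₁ h (hW.hN he₀)
    · exact Finset.disjoint_left.1 hG₂ h (hW.hN he₀)
  -- the model
  have hinf : (sys I B).Infeasible B.N := infeasible_of_not_solution I hI hT hW hL hT3
  have hmin : (sys I B).ChordMinimal B.N e₀ := by
    obtain ⟨z0, hz0⟩ := hmin0
    exact chordMinimal_of_solution_erase I hI hT hW he₀ hz0
  have hconst := const_of_unread I B hun
  have hU1 : ∀ e a, ((sys I B).ρ e a = 0 ∨ (sys I B).ρ e a = mv) ∧ ((sys I B).ρ' e a = 0 ∨ (sys I B).ρ' e a = mv) := by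
    intro e a
    by_cases he : e ∈ B.N
    · rw [(hconst e a 0).1, (hconst e a 0).2]; exact hreads e he
    · rw [(sys_ρ_of_not_mem I B he a).1, (sys_ρ_of_not_mem I B he a).2]; exact ⟨Or.inl rfl, Or.inl rfl⟩
  obtain ⟨hSR, hinf', hmin', hconst'⟩ := U1_package (sys I B) hinf hmv hU1 hconst
  set S' := mapSys (sys I B) (toX mv) with hS'
  set pm : V2 := partner mv with hpm
  have hq2 : ∀ x, (S'.F x).2 + S'.t.2 = qDir I B mv x := q_dir I B mv
  have hq1 : ∀ x, (S'.F x).1 + S'.t.1 = qDir I B pm x := q_par I B mv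
  have hu : ∀ x, S'.u e₀ x = gam B e₀ + qform (B.D e₀) (fun j => I.vars j 2) (fun j => I.vars j 3) x := fun x => by
    rw [hS', mapSys_u]; exact sys_u_eq I B e₀ x
  have hstar := S'.star_star hSR hconst' hinf' he₀ (hmin' e₀ hmin)
  have hZ_iff : ∀ x, (S'.F x).2 = S'.t.2 ↔ qDir I B mv x = 0 := by
    intro x
    rw [← hq2 x]
    constructor
    · intro h; rw [h]; exact zaa _
    · intro h
      have e2 : ∀ a b : ZMod 2, a + b = 0 → a = b := by decide
      exact e2 _ _ h
  -- `γ + κ = 1`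
  have hγκ : gam B e₀ + κ = 1 := by
    obtain ⟨a, s, -, hval⟩ := hmin' e₀ hmin
    have hZa : (S'.F a).2 = S'.t.2 := by
      have := congrArg Prod.snd hval
      rwa [S'.val_snd_of_singleRead hSR] at this
    have h1 := hstar a hZa
    rw [hu, hEQ a, (hZ_iff a).1 hZa, zero_add] at h1
    exact h1
  -- the read constant of the first coordinate and the key containment
  set cpar : ZMod 2 := (S'.ρ e₀ 0).1 + (S'.ρ' e₀ 0).1 with hcpar
  have hvalON : ∀ x (s : Fin m → ZMod 2 × ZMod 2), s e₀ = (1, 1) → S'.val B.N x s = S'.F x + (S'.ρ e₀ 0 + S'.ρ' e₀ 0) := by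
    intro x s hs
    unfold ChordSystem.val ChordSystem.contrib
    rw [hN, sum_singleton, hs, (hconst' e₀ x 0).1, (hconst' e₀ x 0).2]
    simp only [one_smul]
  have hkey : ∀ x, qDir I B mv x = 0 → qDir I B pm x = cpar + 1 := by
    intro x hx
    have hZx : (S'.F x).2 = S'.t.2 := (hZ_iff x).2 hx
    have hu1 : S'.u e₀ x = 1 := hstar x hZx
    have hadm : S'.Adm B.N x (fun _ => ((1 : ZMod 2), (1 : ZMod 2))) := by
      intro e he
      rw [hN, mem_singleton] at he
      subst he
      show (1 : ZMod 2) * 1 = S'.u e x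
      rw [one_mul, hu1]
    have hne := hinf' x _ hadm
    rw [hvalON x _ rfl] at hne
    rcases z01 (qDir I B pm x + cpar) with h0 | h1
    · exfalso
      apply hne
      refine Prod.ext ?_ ?_
      · have h := hq1 x
        simp only [Prod.fst_add]
        have e3 : ∀ f t ρ : ZMod 2, f + t = ρ → f + ρ = t := by decide
        refine e3 _ _ _ (h.trans ?_)
        have e4 : ∀ q c : ZMod 2, q + c = 0 → q = c := by decide
        exact e4 _ _ h0
      · simp only [Prod.snd_add]
        rw [(hSR e₀ 0).1, (hSR e₀ 0).2, add_zero, add_zero]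
        exact hZx
    · have e5 : ∀ q c : ZMod 2, q + c = 1 → q = c + 1 := by decide
      exact e5 _ _ h1
  -- the shifted first coordinate `q̃ = q_{m'} + c` and the containment `{q̃ = 0} ⊆ {Q = κ + 1}`
  set qt : (Fin n → ZMod 2) → ZMod 2 := fun x => qDir I B pm x + cpar with hqt
  have hZt : ∀ x, qt x = 0 → qform (B.D e₀) (fun j => I.vars j 2) (fun j => I.vars j 3) x = κ + 1 := by
    intro x hx
    have hx' : qDir I B pm x = cpar := by
      have e4 : ∀ q c : ZMod 2, q + c = 0 → q = c := by decide
      exact e4 _ _ hx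
    rcases z01 (qDir I B mv x) with h0 | h1
    · have := hkey x h0
      rw [hx'] at this
      exact absurd this (by generalize cpar = c; revert c; decide)
    · rw [hEQ x, h1, add_comm]
  have hBt : ∀ x w, qt (x + w) = qt x + qt w + qt 0 + polarDir I B pm x w := by
    intro x w
    show qDir I B pm (x + w) + cpar = qDir I B pm x + cpar + (qDir I B pm w + cpar) + (qDir I B pm 0 + cpar) + polarDir I B pm x w
    rw [qDir_add]
    generalize qDir I B pm x = s; generalize qDir I B pm w = s'; generalize qDir I B pm 0 = s₀
    generalize polarDir I B pm x w = t; generalize cpar = c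
    revert s s' s₀ t c; decide
  have hrank := rank_four_of_wf I hI hS hB hW hJr he₀
  -- (★): `(EQ)` pins the polar form of `q_m` to that of `Q`
  have hpolQ : polar (B.D e₀) (fun j => I.vars j 2) (fun j => I.vars j 3) = polarDir I B mv := by
    refine polar_unique (qform_add' I (B.D e₀)) fun x w => ?_
    rw [hEQ (x + w), hEQ x, hEQ w, hEQ 0, qDir_add]
    generalize qDir I B mv x = s; generalize qDir I B mv w = s'; generalize qDir I B mv 0 = s₀
    generalize polarDir I B mv x w = t; generalize κ = c
    revert s s' s₀ t c; decide
  have hstarj : ∀ j ∈ B.D e₀, mv.2 * (if j ∈ B.T₁ then 1 else 0) + mv.1 * (if j ∈ B.T₂ then 1 else 0) = (1 : ZMod 2) := by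
    intro j hj
    have hjJ : j ∈ B.J₀ := (mem_sdiff.1 (hW.hD e₀ he₀ hj)).1
    have h := LinearMap.congr_fun (LinearMap.congr_fun hpolQ (Pi.single (I.vars j 2) 1)) (Pi.single (I.vars j 3) 1)
    rw [polar_basis I hI hS, if_pos ((andAdj_iff_mem I hI hS _ j).2 hj), polarDir_single_pair I hI hS hG₁ hG₂ mv hjJ] at h
    exact h.symm
  -- the forest point: a path edge `j ∈ D e₀` and a solution of `J₀ − j`
  have hjJ : j ∈ B.J₀ := (mem_sdiff.1 (hW.hD e₀ he₀ hj)).1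
  have hpriv : ∀ G : Finset (Fin m), (∀ v ∈ privs I B.N, ∀ g ∈ G, I.vars g 2 ≠ v ∧ I.vars g 3 ≠ v) →
      ∀ g ∈ G, I.vars g 2 ≠ I.vars e₀ 2 ∧ I.vars g 2 ≠ I.vars e₀ 3 ∧ I.vars g 3 ≠ I.vars e₀ 2 ∧ I.vars g 3 ≠ I.vars e₀ 3 := by
    intro G hG g hg
    have h2 := hG _ (vars_mem_privs I he₀ (s := 2) (by decide)) g hg
    have h3 := hG _ (vars_mem_privs I he₀ (s := 3) (by decide)) g hg
    exact ⟨h2.1, h3.1, h2.2, h3.2⟩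
  have hGp₁ := hpriv B.G₁ fun v hv => (hun v hv).1
  have hGp₂ := hpriv B.G₂ fun v hv => (hun v hv).2
  obtain ⟨-, hval⟩ := forest_minimality I hI hT hW he₀ hj hGp₁ hGp₂ hz
  have hδ := defect_eq_one I hI hW he₀ hj hT3 hz
  set xz : Fin n → ZMod 2 := fun v => bit (z v) with hxz
  set sz : Fin m → ZMod 2 × ZMod 2 := fun e => (bit (z (I.vars e 2)), bit (z (I.vars e 3))) with hsz
  rw [hδ] at hval
  have hval' : S'.val B.N xz sz = S'.t + toX mv ((if j ∈ B.T₁ then (1 : ZMod 2) else 0), (if j ∈ B.T₂ then (1 : ZMod 2) else 0)) := by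
    rw [hS', mapSys_val, hval, map_add, mapSys_t]
  have hsj := hstarj j hj
  -- second coordinate at the forest point: `q_m = 1`, so `Q = κ + 1`, `u = 0`, `p = p' = 1`
  have h2c : qDir I B mv xz = 1 := by
    have h := congrArg Prod.snd hval'
    rw [S'.val_snd_of_singleRead hSR, Prod.snd_add, toX_snd] at h
    rw [← hq2 xz, h]
    dsimp only
    revert hsj
    generalize S'.t.2 = t; generalize mv.1 = a1; generalize mv.2 = a2
    generalize (if j ∈ B.T₁ then (1 : ZMod 2) else 0) = i1; generalize (if j ∈ B.T₂ then (1 : ZMod 2) else 0) = i2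
    revert t a1 a2 i1 i2; decide
  have hQx : qform (B.D e₀) (fun j => I.vars j 2) (fun j => I.vars j 3) xz = κ + 1 := by
    rw [hEQ xz, h2c, add_comm]
  have hpp : bit (z (I.vars e₀ 2)) = 1 ∧ bit (z (I.vars e₀ 3)) = 1 := by
    have hu0 : (sys I B).u e₀ xz = 0 := by
      rw [sys_u_eq I B e₀ xz, hQx, ← add_assoc, hγκ]
      decide
    rw [hu0, zero_add] at hδ
    have e6 : ∀ a b : ZMod 2, a * b = 1 → a = 1 ∧ b = 1 := by decide
    exact e6 _ _ hδ
  have hsz₀ : sz e₀ = (1, 1) := by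
    show (bit (z (I.vars e₀ 2)), bit (z (I.vars e₀ 3))) = (1, 1)
    rw [hpp.1, hpp.2]
  -- first coordinate at the forest point: `q̃(xz) = m'₂[j∈T₁] + m'₁[j∈T₂]`
  have h1c : qt xz = pm.2 * (if j ∈ B.T₁ then 1 else 0) + pm.1 * (if j ∈ B.T₂ then 1 else 0) := by
    have h := congrArg Prod.fst hval'
    rw [hvalON xz sz hsz₀, Prod.fst_add, Prod.fst_add, Prod.fst_add, toX_fst] at h
    show qDir I B pm xz + cpar = _
    rw [← hq1 xz, hcpar, hpm]
    dsimp only at h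
    revert h
    generalize (S'.F xz).1 = f; generalize S'.t.1 = t; generalize (S'.ρ e₀ 0).1 = ρ₁; generalize (S'.ρ' e₀ 0).1 = ρ₂
    generalize (partner mv).1 = p1; generalize (partner mv).2 = p2
    generalize (if j ∈ B.T₁ then (1 : ZMod 2) else 0) = i1; generalize (if j ∈ B.T₂ then (1 : ZMod 2) else 0) = i2
    revert f t ρ₁ ρ₂ p1 p2 i1 i2; decide
  have hπ : polarDir I B pm (Pi.single (I.vars j 2) 1) (Pi.single (I.vars j 3) 1) = qt xz := by
    rw [h1c, hpm, polarDir_single_pair I hI hS hG₁ hG₂ (partner mv) hjJ]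
  -- a constant `q̃` is impossible
  have not_const : ¬ ∀ x, qt x = 1 := by
    intro h1
    have hzero : polarDir I B pm (Pi.single (I.vars j 2) 1) (Pi.single (I.vars j 3) 1) = 0 := by
      have := hBt (Pi.single (I.vars j 2) 1) (Pi.single (I.vars j 3) 1)
      rw [h1, h1, h1, h1] at this
      have e8 : ∀ t : ZMod 2, (1 : ZMod 2) = 1 + 1 + 1 + t → t = 0 := by decide
      exact e8 _ this
    rw [hπ, h1 xz] at hzero
    exact one_ne_zero hzero
  -- (EQ″) against `q̃` is impossible: `Q = q̃ + κ'` — the polar forms agree, so `q̃(xz) = 1`; then `κ' = κ` and `κ' = κ + 1`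
  have no_EQ' : ∀ κ' : ZMod 2, (∀ x, qform (B.D e₀) (fun j => I.vars j 2) (fun j => I.vars j 3) x = qt x + κ') → False := by
    intro κ' hκ'
    have hpol2 : polar (B.D e₀) (fun j => I.vars j 2) (fun j => I.vars j 3) = polarDir I B pm := by
      refine polar_unique (qform_add' I (B.D e₀)) fun x w => ?_
      rw [hκ' (x + w), hκ' x, hκ' w, hκ' 0, hBt]
      generalize qt x = s; generalize qt w = s'; generalize qt 0 = s₀
      generalize polarDir I B pm x w = t; generalize κ' = c
      revert s s' s₀ t c; decide
    have hone : qt xz = 1 := by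
      have h := LinearMap.congr_fun (LinearMap.congr_fun hpol2 (Pi.single (I.vars j 2) 1)) (Pi.single (I.vars j 3) 1)
      rw [polar_basis I hI hS, if_pos ((andAdj_iff_mem I hI hS _ j).2 hj), hπ] at h
      exact h.symm
    have hκ₁ : κ' = κ := by
      have h := hκ' xz
      rw [hQx, hone] at h
      have e9 : ∀ a b : ZMod 2, a + 1 = 1 + b → b = a := by decide
      exact e9 _ _ h
    -- some point with `q̃ = 0`
    obtain ⟨x₀, hx₀⟩ : ∃ x₀, qt x₀ = 0 := by
      by_contra hno
      push Not at hno
      exact not_const fun x => (z01 (qt x)).resolve_left (hno x)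
    have h := hκ' x₀
    rw [hZt x₀ hx₀, hx₀, zero_add, hκ₁] at h
    exact absurd h (by generalize κ = c; revert c; decide)
  -- run the forcing table on `(Q, q̃)`
  rcases forcing_cases hBt (qform_add' I (B.D e₀)) hrank hZt with h1 | ⟨κ', hκ'⟩ | ⟨ν₁, ν₂, hν₁, hν₂, κ', h⟩ |
      ⟨a, b, -, hqf, m₁, m₂, hm₁, hm₂, hQf⟩
  · exact absurd h1 not_const
  · -- (EQ′)
    exact (no_EQ' κ' hκ').elim
  · -- (EXC′): by `exc_unit_core` against `q̃`, either (EQ″) — dead — or `D e₀` is a CONS-T pair, so `J₀ = D e₀ + e₀` is a triangle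
    rcases exc_unit_core I hI hS hB hW hr he₀ heG pm hBt hZt hν₁ hν₂ h with ⟨κ'', hκ''⟩ | ⟨j₁, j₂, σ, τ', hne, hDe, -⟩
    · exact (no_EQ' κ'' hκ'').elim
    · rw [J₀_eq_of_single I hI hT hW hX hP hN, card_insert_of_notMem heD, hDe, card_pair hne]
  · -- (NOR′): a CONS-T unit, so `J₀ = D e₀ + e₀` is a triangle
    have hq'' : ∀ x, qDir I B pm x = (polarDir I B pm x b + (qt b + qt 0)) * (polarDir I B pm x a + (qt a + qt 0)) + (1 + cpar) := by
      intro x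
      have hx := hqf x
      have e10 : ∀ q c P : ZMod 2, q + c = P + 1 → q = P + (1 + c) := by decide
      exact e10 _ _ _ hx
    obtain ⟨j₁, j₂, σ, τ', hne, hDe, -⟩ :=
      nor_unit_of_dir_const I hI hS hB hW hr he₀ heG pm hq'' hm₁ hm₂ (c := κ + 1) hQf
    rw [J₀_eq_of_single I hI hT hW hX hP hN, card_insert_of_notMem heD, hDe, card_pair hne]


end Summit.PneNP.PneNP.Theorems.PstarUnionEQ1Witness
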